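import Literature.NumberTheory.Automorphic.BrandtMatrixRamified
import Literature.NumberTheory.Automorphic.EichlerOrderLocalConjugacy
import HarnessLib

/-!
# The Atkin–Lehner ideal `𝔔_{p^e}` of an Eichler order at a prime power `p^e ∥ N` of the level
# (Vignéras, LNM 800, Ch. II §2: the normaliser of an Eichler order; Bertolini–Darmon 1996 §1.5, §2.3: `W_{l⁺}`)

Topic `NumberTheory/Automorphic`. Three definitions with bodies (`atkinLehnerIdeal`,
`AtkinLehner.IsLevelShape`, `AtkinLehner.IsALShape`) and theorems; no named fact, no `sorry`, no instance.
Companion of `RamifiedPrimeIdeal.lean` / `BrandtMatrixRamified.lean` (the two-sided prime `𝔓_q` of an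
order maximal at a ramified `q`, `I ↦ I 𝔓_q` the Atkin–Lehner involution `W_{q⁻}`): here the SPLIT level
primes. For a `ℤ`-order `O` of a quaternion algebra `B` over `ℚ` and an integer `m ≥ 1`

  `𝔔_m(O) := {x ∈ O : trd(x y) ∈ m ℤ for all y ∈ O} = O ∩ m O♯`  (`atkinLehnerIdeal O m`),

`O♯` the dual of `O` for the trace form. For an Eichler order of level `N` and a split prime `p` with
`p^e ∥ N`, the local order is `O_p = (ℤ_p ℤ_p; p^e ℤ_p ℤ_p)` in a matrix model, its trace dual is
`(ℤ_p p^{-e}ℤ_p; ℤ_p ℤ_p)`, so `(𝔔_{p^e})_p = (p^e ℤ_p, ℤ_p; p^e ℤ_p, p^e ℤ_p) = O_p w = w O_p` with the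
Atkin–Lehner element `w = (0 1; p^e 0)` normalising `O_p` (Vignéras II §2; Bertolini–Darmon §1.5: "the
space `(R ⊗ ℤ_p)^× \ B_p^× / ℚ_p^×` is equipped with the standard involution `g ↦ (0 1; p 0) g`"). Right
multiplication `I ↦ I 𝔔_{p^e}` of invertible right `O`-ideals is the Atkin–Lehner involution `W_{p⁺}` on
ideal classes; on Gross points it is built in `EllipticCurves/GrossPointsAtkinLehnerLevel.lean`.

## Contents

* §1 `atkinLehnerIdeal O m` and its global algebra: two-sided (`mul_mem_atkinLehnerIdeal_left/right`,
  `order_mul_atkinLehnerIdeal`, `atkinLehnerIdeal_mul_order`), `m O ⊆ 𝔔_m ⊆ O`, `𝔔_1 = O`, `m I ⊆ I 𝔔_m ⊆ I`,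
  and **`(𝔔_m)_(q) = O_(q)`, `(I 𝔔_m)_(q) = I_(q)` at primes `q ∤ m`** (`localAt_…_of_coprime`).
* §2 the local shapes `IsLevelShape e M` (`M ∈ (ℤ_p ℤ_p; p^e ℤ_p ℤ_p)`) and `IsALShape e M`
  (`M ∈ (p^e ℤ_p, ℤ_p; p^e ℤ_p, p^e ℤ_p)`) of `2 × 2` matrices over `ℚ_p` and their `p`-adic bookkeeping:
  `tr(X Y) ∈ p^e ℤ_p` for `X` AL-shaped, `Y` level-shaped; `W⁻¹ X` level-shaped for AL-shaped `W, X` with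
  `‖det W‖ = p^{-e}`; `p^{-e} W²` and `p^e W⁻²` level-shaped.
* §3 for a level model `O_(p) = Φ⁻¹(level shape)` (`Φ : B →ₐ[ℚ] M₂(ℚ_p)`; every Eichler package has one
  at `p ∤ N⁻`, §5): **`x ∈ (𝔔_{p^e})_(p) ↔ Φ(x)` AL-shaped** (`mem_localAt_atkinLehnerIdeal_iff`; ⇒ by
  the trace test against `y` with `Φ(y) ≡ E_{ii}`, density of `Φ(B)`; ⇐ because `trd(x y)` is an integer of
  `p`-adic norm `≤ p^{-e}`); **an Atkin–Lehner element `w ∈ 𝔔_{p^e} ∩ Bˣ` with `Φ(w)` AL-shaped and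
  `‖nrd w‖_p = p^{-e}` exists** (`exists_atkinLehner_generator`, `Φ(w) ≡ k (0 1; p^e 0)`); **`(𝔔_{p^e})_(p)
  = w O_(p)`** (`localAt_atkinLehnerIdeal_eq_units_smul`), **`w² O_(p) = p^e O_(p)`**
  (`mul_self_smul_localAt_eq`), `(I 𝔔)_(p) = β w O_(p)` if `I_(p) = β O_(p)`
  (`localAt_mul_atkinLehnerIdeal_self`); hence **`I 𝔔_{p^e}` is an invertible right `O`-ideal** and
  **`I 𝔔_{p^e} 𝔔_{p^e} = p^e I`** (`isInvertibleRightIdeal_mul_atkinLehnerIdeal`,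
  `mul_atkinLehnerIdeal_mul_atkinLehnerIdeal`) — `W_{p⁺}` is an involution on ideal classes.
* §4 `𝔔_m 𝔔_{m'} = 𝔔_{m'} 𝔔_m` (`m, m'` coprime) and `𝔔_m 𝔓_q = 𝔓_q 𝔔_m` (`q ∤ m`) — two-sided ideals that are
  locally trivial at complementary primes commute (`mul_comm_of_forall_localAt`); and the key local lemma
  for Bertolini–Darmon's *"`W_{l⁺}` sends a Heegner point to one with the opposite orientation at `l`"*:
  `AtkinLehner.norm_disc_lt_one_of_commute` — **an AL-shaped `U` with `‖det U‖ = p^{-e}` (`e ≥ 1`) commutes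
  with no level-shaped `G` of unit discriminant `(tr G)² − 4 det G`** (the `(0,1)` entry of `GU = UG`
  forces `G₀₀ ≡ G₁₁ (mod p)`, and `G₁₀ ≡ 0`, so `disc G = (G₀₀ − G₁₁)² + 4 G₀₁ G₁₀ ≡ 0`): an order of
  conductor prime to `p`, optimally embedded in the level-`p^e` Eichler order at a split `p`, is never
  normalised by an Atkin–Lehner element commuting with it; with the multiplicativity of the orientation
  characters `X ↦ X₀₀, X₁₁ (mod p)` on level-shaped matrices (`norm_mul_apply_zero_zero_lt_one`, `…_one_one_…`,
  `norm_det_eq_one_of_diag`).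
* §5 level models: `EichlerPackage.exists_isLevelShape_iff`, `Brandt.XiSetup.exists_isLevelShape_iff`
  (`O_(p) = Φ⁻¹(ℤ_p ℤ_p; p^{v_p(N⁺)} ℤ_p ℤ_p)` at `p ∤ N⁻`, from the tree's
  `IsEichlerOrder.exists_conjUnit_localAt_iff_eichler`).

Not here: the identification `𝔔_q = 𝔓_q` at a ramified `q` of a maximal order (`q 𝔓_q⁻¹ = 𝔓_q`), and the
normaliser of `O_p` as a group.

## References

* [VignerasLNM800] M.-F. Vignéras, *Arithmétique des algèbres de quaternions*, LNM 800 (1980), Ch. I §4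
  Lemme 4.7 (dual lattice, different), Ch. II §2 (ordres d'Eichler de niveau `p^n`, leur normalisateur),
  Ch. III §5 (niveau, idéaux bilatères) [held `book:vignerasnd-arithmetique-des-algebres-de-quaternions`].
* [BertoliniDarmon1996] M. Bertolini, H. Darmon, *Heegner points on Mumford–Tate curves*, Invent. Math. 126
  (1996), §1.1 (oriented Eichler orders), §1.5 (the Atkin–Lehner involutions `W_{p⁺}`, `W_{p⁻}`), §2.3
  Lemma 2.4, Lemma 2.5 and its proof (PDF pp. 5–6, 9–10, 19; held `paper:doi-10-1007-s002220050105`).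
-/

noncomputable section

open scoped Pointwise

universe u

namespace Literature.NumberTheory.Automorphic

variable {B : Type u} [Ring B] [Algebra ℚ B]

/-! ### §1 The ideal `𝔔_m(O) = {x ∈ O : trd(x O) ⊆ m ℤ}` -/

/-- **The Atkin–Lehner ideal of level `m` of a lattice `O`**: the elements `x ∈ O` with
`trd(x y) ∈ m ℤ` for all `y ∈ O`, i.e. `O ∩ m O♯` with `O♯` the dual of `O` for the trace form.
For `O` an Eichler order of level `N` in a quaternion algebra over `ℚ` and `m = p^e ∥ N` at a split
prime `p` this is the two-sided `O`-ideal `O w_p = w_p O` of the Atkin–Lehner element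
`w_p = (0 1; p^e 0)` of the local model `O_p = (ℤ_p ℤ_p; p^e ℤ_p ℤ_p)` (whose trace dual is
`(ℤ_p p^{-e}ℤ_p; ℤ_p ℤ_p)`); at a ramified prime `p` of a maximal order it is the unique prime
above `p` (`p 𝔓⁻¹ = 𝔓`, the different being `𝔓`). [cite: VignerasLNM800, Ch. I §4 Lemme 4.7 (dual and different), Ch. II §2 (ordres d'Eichler, normalisateur), Ch. III §5] -/
def atkinLehnerIdeal (O : Submodule ℤ B) (m : ℕ) : Submodule ℤ B where
  carrier := {x | x ∈ O ∧ ∀ y ∈ O, ∃ n : ℤ, reducedTrace ℚ B (x * y) = m * n}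
  add_mem' := by
    rintro a b ⟨ha, ha'⟩ ⟨hb, hb'⟩
    refine ⟨O.add_mem ha hb, fun y hy => ?_⟩
    obtain ⟨n, hn⟩ := ha' y hy
    obtain ⟨n', hn'⟩ := hb' y hy
    exact ⟨n + n', by rw [add_mul, map_add, hn, hn']; push_cast; ring⟩
  zero_mem' := ⟨O.zero_mem, fun y _ => ⟨0, by simp⟩⟩
  smul_mem' := by
    rintro k x ⟨hx, hx'⟩
    refine ⟨O.smul_mem k hx, fun y hy => ?_⟩
    obtain ⟨n, hn⟩ := hx' y hy
    exact ⟨k * n, by rw [smul_mul_assoc, map_zsmul, hn]; push_cast; ring⟩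

/-- Membership in `𝔔_m(O)` (definitional). [cite: VignerasLNM800, Ch. I §4 Lemme 4.7 (dual lattice) and Ch. III §5 (idéaux bilatères)] -/
theorem mem_atkinLehnerIdeal_iff {O : Submodule ℤ B} {m : ℕ} {x : B} :
    x ∈ atkinLehnerIdeal O m ↔ x ∈ O ∧ ∀ y ∈ O, ∃ n : ℤ, reducedTrace ℚ B (x * y) = m * n :=
  Iff.rfl

/-- `𝔔_m(O) ⊆ O`. [cite: VignerasLNM800, Ch. I §4 Lemme 4.7 (dual lattice) and Ch. III §5 (idéaux bilatères)] -/
theorem atkinLehnerIdeal_le (O : Submodule ℤ B) (m : ℕ) : atkinLehnerIdeal O m ≤ O := fun _ hx => hx.1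

variable {O : Submodule ℤ B} {m : ℕ}

/-- `𝔔_m(O)` is a right `O`-module: `x a ∈ 𝔔_m` for `x ∈ 𝔔_m`, `a ∈ O` (`trd((x a) y) = trd(x (a y))`). [cite: VignerasLNM800, Ch. I §4 Lemme 4.7 (dual lattice) and Ch. III §5 (idéaux bilatères)] -/
theorem mul_mem_atkinLehnerIdeal_right (hO : IsZOrder O) {x a : B} (hx : x ∈ atkinLehnerIdeal O m)
    (ha : a ∈ O) : x * a ∈ atkinLehnerIdeal O m := by
  refine ⟨hO.mul_mem _ hx.1 _ ha, fun y hy => ?_⟩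
  obtain ⟨n, hn⟩ := hx.2 (a * y) (hO.mul_mem _ ha _ hy)
  exact ⟨n, by rw [mul_assoc, hn]⟩

/-- `I 𝔔_m ⊆ I` for a right `O`-module `I`. [cite: VignerasLNM800, Ch. I §4 Lemme 4.7 (dual lattice) and Ch. III §5 (idéaux bilatères)] -/
theorem mul_atkinLehnerIdeal_le {I : Submodule ℤ B} (hI : IsInvertibleRightIdeal O I) :
    I * atkinLehnerIdeal O m ≤ I :=
  Submodule.mul_le.mpr fun _ hx _ hy => hI.mul_mem hx (atkinLehnerIdeal_le O m hy)

/-- `𝔔_m(O)` is a left `O`-module: `a x ∈ 𝔔_m` for `a ∈ O`, `x ∈ 𝔔_m`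
(`trd((a x) y) = trd(x (y a))`, the reduced trace being central). [cite: VignerasLNM800, Ch. I §4 Lemme 4.7 (dual lattice) and Ch. III §5 (idéaux bilatères)] -/
theorem mul_mem_atkinLehnerIdeal_left (hO : IsZOrder O) {a x : B} (ha : a ∈ O)
    (hx : x ∈ atkinLehnerIdeal O m) : a * x ∈ atkinLehnerIdeal O m := by
  refine ⟨hO.mul_mem _ ha _ hx.1, fun y hy => ?_⟩
  obtain ⟨n, hn⟩ := hx.2 (y * a) (hO.mul_mem _ hy _ ha)
  exact ⟨n, by rw [mul_assoc, reducedTrace_mul_comm, mul_assoc, hn]⟩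

/-- **`O 𝔔_m = 𝔔_m`** (two-sided ideal). [cite: VignerasLNM800, Ch. I §4 Lemme 4.7 (dual lattice) and Ch. III §5 (idéaux bilatères)] -/
theorem order_mul_atkinLehnerIdeal (hO : IsZOrder O) : O * atkinLehnerIdeal O m = atkinLehnerIdeal O m := by
  refine le_antisymm (Submodule.mul_le.mpr fun a ha x hx => mul_mem_atkinLehnerIdeal_left hO ha hx) fun x hx => ?_
  rw [← one_mul x]
  exact Submodule.mul_mem_mul hO.one_mem hx

/-- **`𝔔_m O = 𝔔_m`** (two-sided ideal). [cite: VignerasLNM800, Ch. I §4 Lemme 4.7 (dual lattice) and Ch. III §5 (idéaux bilatères)] -/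
theorem atkinLehnerIdeal_mul_order (hO : IsZOrder O) : atkinLehnerIdeal O m * O = atkinLehnerIdeal O m := by
  refine le_antisymm (Submodule.mul_le.mpr fun x hx a ha => mul_mem_atkinLehnerIdeal_right hO hx ha) fun x hx => ?_
  rw [← mul_one x]
  exact Submodule.mul_mem_mul hx hO.one_mem

variable [IsQuaternionAlgebra ℚ B]


/-- **`m O ⊆ 𝔔_m(O)`**: traces of elements of an order are integers. [cite: VignerasLNM800, Ch. I §4 Lemme 4.1] -/
theorem smul_le_atkinLehnerIdeal (hO : IsZOrder O) : (m : ℤ) • O ≤ atkinLehnerIdeal O m := by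
  intro x hx
  obtain ⟨z, hz, rfl⟩ := (Submodule.mem_smul_pointwise_iff_exists x _ O).mp hx
  refine ⟨O.smul_mem _ hz, fun y hy => ?_⟩
  obtain ⟨t, -, ht, -⟩ := hO.toIsOrder.exists_int_reducedTrace_reducedNorm (hO.mul_mem _ hz _ hy)
  exact ⟨t, by rw [smul_mul_assoc, map_zsmul, ht, zsmul_eq_mul, Int.cast_natCast]⟩

/-- `m · 1 ∈ 𝔔_m(O)`. [cite: VignerasLNM800, Ch. I §4 Lemme 4.1 and Lemme 4.7] -/
theorem natCast_smul_one_mem_atkinLehnerIdeal (hO : IsZOrder O) : (m : ℤ) • (1 : B) ∈ atkinLehnerIdeal O m :=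
  smul_le_atkinLehnerIdeal hO (Submodule.smul_mem_pointwise_smul _ _ O hO.one_mem)

/-- `𝔔_1(O) = O` (an order is integral for the trace form). [cite: VignerasLNM800, Ch. I §4 Lemme 4.1 and Lemme 4.7] -/
theorem atkinLehnerIdeal_one (hO : IsZOrder O) : atkinLehnerIdeal O 1 = O := by
  refine le_antisymm (atkinLehnerIdeal_le O 1) fun x hx => ?_
  have h := smul_le_atkinLehnerIdeal (m := 1) hO (Submodule.smul_mem_pointwise_smul x ((1 : ℕ) : ℤ) O hx)
  rwa [Nat.cast_one, one_smul] at h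


/-- `m I ⊆ I 𝔔_m` (`m · 1 ∈ 𝔔_m`). [cite: VignerasLNM800, Ch. I §4 Lemme 4.7 (dual lattice) and Ch. III §5 (idéaux bilatères)] -/
theorem smul_le_mul_atkinLehnerIdeal (hO : IsZOrder O) (I : Submodule ℤ B) :
    (m : ℤ) • I ≤ I * atkinLehnerIdeal O m := by
  intro z hz
  obtain ⟨x, hx, rfl⟩ := (Submodule.mem_smul_pointwise_iff_exists z _ I).mp hz
  have : (m : ℤ) • x = x * ((m : ℤ) • (1 : B)) := by rw [mul_smul_comm, mul_one]
  rw [this]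
  exact Submodule.mul_mem_mul hx (natCast_smul_one_mem_atkinLehnerIdeal hO)

/-- **Away from `m` the Atkin–Lehner ideal is the whole order**: `(𝔔_m)_(q) = O_(q)` for primes
`q ∤ m`. [cite: VignerasLNM800, Ch. III §5 Prop. 5.1 (propriétés locales)] -/
theorem localAt_atkinLehnerIdeal_of_coprime (hO : IsZOrder O) (hm : m ≠ 0) {q : ℕ} (hmq : m.Coprime q) :
    localAt q (atkinLehnerIdeal O m) = localAt q O :=
  (localAt_eq_of_smul_le (atkinLehnerIdeal_le O m) hm hmq fun x hx =>
    smul_le_atkinLehnerIdeal hO (Submodule.smul_mem_pointwise_smul x _ O hx)).symm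

/-- Away from `m`, `(I 𝔔_m)_(q) = I_(q)`. [cite: VignerasLNM800, Ch. III §5 Prop. 5.1 (propriétés locales)] -/
theorem localAt_mul_atkinLehnerIdeal_of_coprime (hO : IsZOrder O) (hm : m ≠ 0) {I : Submodule ℤ B}
    (hI : IsInvertibleRightIdeal O I) {q : ℕ} (hmq : m.Coprime q) :
    localAt q (I * atkinLehnerIdeal O m) = localAt q I :=
  (localAt_eq_of_smul_le (mul_atkinLehnerIdeal_le hI) hm hmq fun x hx =>
    smul_le_mul_atkinLehnerIdeal hO I (Submodule.smul_mem_pointwise_smul x _ I hx)).symm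

/-! ### §2 Local shapes: `2 × 2` matrices over `ℚ_p` of level `p^e` and of Atkin–Lehner type -/

namespace AtkinLehner

variable {p : ℕ} [hp : Fact p.Prime]

/-- `p^{-e} ≤ 1`. [folklore] -/
private theorem zpow_neg_le_one (e : ℕ) : (p : ℝ) ^ (-(e : ℤ)) ≤ 1 :=
  zpow_le_one_of_nonpos₀ (by exact_mod_cast hp.out.one_lt.le) (by omega)

/-- `0 < p^{-e}`. [folklore] -/
private theorem zpow_neg_pos (e : ℕ) : 0 < (p : ℝ) ^ (-(e : ℤ)) :=
  zpow_pos (by exact_mod_cast hp.out.pos) _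

/-- `‖p^e‖_p = p^{-e}`. [folklore] -/
private theorem norm_natCast_pow (e : ℕ) : ‖((p ^ e : ℕ) : ℚ_[p])‖ = (p : ℝ) ^ (-(e : ℤ)) := by
  rw [Nat.cast_pow, norm_pow, Padic.norm_p, inv_pow, zpow_neg, zpow_natCast]

/-- The **level-`p^e` shape** of a `2 × 2` matrix over `ℚ_p`: integral entries and lower-left entry in
`p^e ℤ_p` — the local Eichler order `(ℤ_p ℤ_p; p^e ℤ_p ℤ_p)` of level `p^e`. [cite: VignerasLNM800, Ch. II §2 (ordres d'Eichler)] -/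
def IsLevelShape (e : ℕ) (M : Matrix (Fin 2) (Fin 2) ℚ_[p]) : Prop :=
  (∀ i j, ‖M i j‖ ≤ 1) ∧ ‖M 1 0‖ ≤ (p : ℝ) ^ (-(e : ℤ))

/-- The **Atkin–Lehner shape** at level `p^e`: entries `(0,0)`, `(1,0)`, `(1,1)` in `p^e ℤ_p` and
`(0,1)` in `ℤ_p` — the two-sided ideal `(p^e ℤ_p, ℤ_p; p^e ℤ_p, p^e ℤ_p) = O_p w = w O_p`,
`w = (0 1; p^e 0)`, of the local Eichler order `O_p` of level `p^e`. [cite: VignerasLNM800, Ch. II §2 (ordres d'Eichler, normalisateur)] -/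
def IsALShape (e : ℕ) (M : Matrix (Fin 2) (Fin 2) ℚ_[p]) : Prop :=
  ‖M 0 0‖ ≤ (p : ℝ) ^ (-(e : ℤ)) ∧ ‖M 0 1‖ ≤ 1 ∧ ‖M 1 0‖ ≤ (p : ℝ) ^ (-(e : ℤ)) ∧
    ‖M 1 1‖ ≤ (p : ℝ) ^ (-(e : ℤ))

variable {e : ℕ}

/-- An Atkin–Lehner-shaped matrix is level-shaped (`p^e ℤ_p ⊆ ℤ_p`): `w O_p ⊆ O_p`. [cite: VignerasLNM800, Ch. II §2 (ordres d'Eichler de niveau p^n)] -/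
theorem IsALShape.isLevelShape {M : Matrix (Fin 2) (Fin 2) ℚ_[p]} (h : IsALShape e M) : IsLevelShape e M := by
  obtain ⟨h00, h01, h10, h11⟩ := h
  have hr := zpow_neg_le_one (p := p) e
  refine ⟨fun i j => ?_, h10⟩
  fin_cases i <;> fin_cases j
  · exact h00.trans hr
  · exact h01
  · exact h10.trans hr
  · exact h11.trans hr

/-- `‖a b + c d‖ ≤ max (‖a‖‖b‖) (‖c‖‖d‖)` bookkeeping: a sum of two products is bounded by `t` when
both products are. [folklore] -/
private theorem norm_add_mul_le {a b c d : ℚ_[p]} {s t : ℝ} (h₁ : ‖a‖ * ‖b‖ ≤ s) (h₂ : ‖c‖ * ‖d‖ ≤ t) :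
    ‖a * b + c * d‖ ≤ max s t :=
  (Padic.nonarchimedean _ _).trans (max_le_max (by rw [norm_mul]; exact h₁) (by rw [norm_mul]; exact h₂))

/-- **`tr(X Y) ∈ p^e ℤ_p` for `X` Atkin–Lehner-shaped and `Y` level-shaped** (`w O_p = p^e O_p♯`). [cite: VignerasLNM800, Ch. I §4 Lemme 4.7, Ch. II §2] -/
theorem norm_trace_mul_le {X Y : Matrix (Fin 2) (Fin 2) ℚ_[p]} (hX : IsALShape e X) (hY : IsLevelShape e Y) :
    ‖(X * Y).trace‖ ≤ (p : ℝ) ^ (-(e : ℤ)) := by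
  obtain ⟨h00, h01, h10, h11⟩ := hX
  obtain ⟨hY1, hY10⟩ := hY
  set r := (p : ℝ) ^ (-(e : ℤ))
  have hr0 := zpow_neg_pos (p := p) e
  rw [Matrix.trace_fin_two, Matrix.mul_apply, Matrix.mul_apply, Fin.sum_univ_two, Fin.sum_univ_two]
  refine (Padic.nonarchimedean _ _).trans (max_le ?_ ?_)
  · refine (norm_add_mul_le (s := r) (t := r) ?_ ?_).trans (max_le le_rfl le_rfl)
    · exact (mul_le_mul h00 (hY1 0 0) (norm_nonneg _) hr0.le).trans (mul_one r).le
    · exact (mul_le_mul h01 hY10 (norm_nonneg _) zero_le_one).trans (one_mul r).le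
  · refine (norm_add_mul_le (s := r) (t := r) ?_ ?_).trans (max_le le_rfl le_rfl)
    · exact (mul_le_mul h10 (hY1 0 1) (norm_nonneg _) hr0.le).trans (mul_one r).le
    · exact (mul_le_mul h11 (hY1 1 1) (norm_nonneg _) hr0.le).trans (mul_one r).le

/-- **`tr(X Y) ∈ ℤ_p` for level-shaped (integral) `X, Y`.** [folklore] -/
private theorem norm_trace_mul_le_one {X Y : Matrix (Fin 2) (Fin 2) ℚ_[p]} (hX : IsLevelShape e X) (hY : IsLevelShape e Y) :
    ‖(X * Y).trace‖ ≤ 1 :=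
  Padic.norm_trace_mul_le_one hX.1 hY.1

/-- The product bounds for an Atkin–Lehner-shaped `W` against an Atkin–Lehner-shaped `X`:
the entries of `adj(W) X` lie in `(p^e, p^e; p^{2e}, p^e)`. [folklore] -/
private theorem norm_adjugate_mul_apply_le {W X : Matrix (Fin 2) (Fin 2) ℚ_[p]} (hW : IsALShape e W) (hX : IsALShape e X) :
    ‖(W.adjugate * X) 0 0‖ ≤ (p : ℝ) ^ (-(e : ℤ)) ∧ ‖(W.adjugate * X) 0 1‖ ≤ (p : ℝ) ^ (-(e : ℤ)) ∧
      ‖(W.adjugate * X) 1 0‖ ≤ (p : ℝ) ^ (-(e : ℤ)) * (p : ℝ) ^ (-(e : ℤ)) ∧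
        ‖(W.adjugate * X) 1 1‖ ≤ (p : ℝ) ^ (-(e : ℤ)) := by
  obtain ⟨w00, w01, w10, w11⟩ := hW
  obtain ⟨x00, x01, x10, x11⟩ := hX
  set r := (p : ℝ) ^ (-(e : ℤ))
  have hr0 := zpow_neg_pos (p := p) e
  have hr1 := zpow_neg_le_one (p := p) e
  have hrr : r * r ≤ r := (mul_le_mul_of_nonneg_left hr1 hr0.le).trans (mul_one r).le
  rw [Matrix.adjugate_fin_two]
  simp only [Matrix.mul_apply, Fin.sum_univ_two, Matrix.of_apply, Matrix.cons_val', Matrix.cons_val_zero,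
    Matrix.cons_val_one, Matrix.cons_val_fin_one, Matrix.empty_val']
  refine ⟨?_, ?_, ?_, ?_⟩
  · refine (norm_add_mul_le (s := r) (t := r) ?_ ?_).trans (max_le le_rfl le_rfl)
    · exact (mul_le_mul w11 x00 (norm_nonneg _) hr0.le).trans hrr
    · rw [norm_neg]; exact (mul_le_mul w01 x10 (norm_nonneg _) zero_le_one).trans (one_mul r).le
  · refine (norm_add_mul_le (s := r) (t := r) ?_ ?_).trans (max_le le_rfl le_rfl)
    · exact (mul_le_mul w11 x01 (norm_nonneg _) hr0.le).trans (mul_one r).le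
    · rw [norm_neg]; exact (mul_le_mul w01 x11 (norm_nonneg _) zero_le_one).trans (one_mul r).le
  · refine (norm_add_mul_le (s := r * r) (t := r * r) ?_ ?_).trans (max_le le_rfl le_rfl)
    · rw [norm_neg]; exact mul_le_mul w10 x00 (norm_nonneg _) hr0.le
    · exact mul_le_mul w00 x10 (norm_nonneg _) hr0.le
  · refine (norm_add_mul_le (s := r) (t := r) ?_ ?_).trans (max_le le_rfl le_rfl)
    · rw [norm_neg]; exact (mul_le_mul w10 x01 (norm_nonneg _) hr0.le).trans (mul_one r).le
    · exact (mul_le_mul w00 x11 (norm_nonneg _) hr0.le).trans hrr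

/-- **`W⁻¹ X` is level-shaped** for Atkin–Lehner-shaped `W, X` with `‖det W‖ = p^{-e}`: the local
ideal `W O_p` contains every Atkin–Lehner-shaped matrix (`w O_p = (p^e, 1; p^e, p^e)`). [cite: VignerasLNM800, Ch. II §2] -/
theorem isLevelShape_inv_mul {W X : Matrix (Fin 2) (Fin 2) ℚ_[p]} (hW : IsALShape e W)
    (hdet : ‖W.det‖ = (p : ℝ) ^ (-(e : ℤ))) (hX : IsALShape e X) : IsLevelShape e (W⁻¹ * X) := by
  set r := (p : ℝ) ^ (-(e : ℤ))
  have hr0 := zpow_neg_pos (p := p) e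
  have hd0 : W.det ≠ 0 := fun h => by rw [h, norm_zero] at hdet; exact hr0.ne hdet
  obtain ⟨h00, h01, h10, h11⟩ := norm_adjugate_mul_apply_le hW hX
  have key : ∀ i j, ‖(W⁻¹ * X) i j‖ = r⁻¹ * ‖(W.adjugate * X) i j‖ := fun i j => by
    rw [Matrix.inv_def, Ring.inverse_eq_inv', Matrix.smul_mul, Matrix.smul_apply, smul_eq_mul, norm_mul,
      norm_inv, hdet]
  have hri : r⁻¹ * r = 1 := inv_mul_cancel₀ hr0.ne'
  refine ⟨fun i j => ?_, ?_⟩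
  · rw [key]
    fin_cases i <;> fin_cases j
    · calc r⁻¹ * ‖(W.adjugate * X) 0 0‖ ≤ r⁻¹ * r := by gcongr
        _ = 1 := hri
    · calc r⁻¹ * ‖(W.adjugate * X) 0 1‖ ≤ r⁻¹ * r := by gcongr
        _ = 1 := hri
    · calc r⁻¹ * ‖(W.adjugate * X) 1 0‖ ≤ r⁻¹ * (r * r) := by gcongr
        _ = 1 * r := by rw [← mul_assoc, hri]
        _ ≤ 1 := by rw [one_mul]; exact zpow_neg_le_one e
    · calc r⁻¹ * ‖(W.adjugate * X) 1 1‖ ≤ r⁻¹ * r := by gcongr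
        _ = 1 := hri
  · rw [key]
    calc r⁻¹ * ‖(W.adjugate * X) 1 0‖ ≤ r⁻¹ * (r * r) := by gcongr
      _ = r := by rw [← mul_assoc, hri, one_mul]

/-- The entries of `W²` for an Atkin–Lehner-shaped `W` lie in `(p^e, p^e; p^{2e}, p^e)`. [folklore] -/
private theorem norm_mul_self_apply_le {W : Matrix (Fin 2) (Fin 2) ℚ_[p]} (hW : IsALShape e W) :
    ‖(W * W) 0 0‖ ≤ (p : ℝ) ^ (-(e : ℤ)) ∧ ‖(W * W) 0 1‖ ≤ (p : ℝ) ^ (-(e : ℤ)) ∧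
      ‖(W * W) 1 0‖ ≤ (p : ℝ) ^ (-(e : ℤ)) * (p : ℝ) ^ (-(e : ℤ)) ∧ ‖(W * W) 1 1‖ ≤ (p : ℝ) ^ (-(e : ℤ)) := by
  obtain ⟨w00, w01, w10, w11⟩ := hW
  set r := (p : ℝ) ^ (-(e : ℤ))
  have hr0 := zpow_neg_pos (p := p) e
  have hr1 := zpow_neg_le_one (p := p) e
  have hrr : r * r ≤ r := (mul_le_mul_of_nonneg_left hr1 hr0.le).trans (mul_one r).le
  simp only [Matrix.mul_apply, Fin.sum_univ_two]
  refine ⟨?_, ?_, ?_, ?_⟩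
  · refine (norm_add_mul_le (s := r) (t := r) ?_ ?_).trans (max_le le_rfl le_rfl)
    · exact (mul_le_mul w00 w00 (norm_nonneg _) hr0.le).trans hrr
    · exact (mul_le_mul w01 w10 (norm_nonneg _) zero_le_one).trans (one_mul r).le
  · refine (norm_add_mul_le (s := r) (t := r) ?_ ?_).trans (max_le le_rfl le_rfl)
    · exact (mul_le_mul w00 w01 (norm_nonneg _) hr0.le).trans (mul_one r).le
    · exact (mul_le_mul w01 w11 (norm_nonneg _) zero_le_one).trans (one_mul r).le
  · refine (norm_add_mul_le (s := r * r) (t := r * r) ?_ ?_).trans (max_le le_rfl le_rfl)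
    · exact mul_le_mul w10 w00 (norm_nonneg _) hr0.le
    · exact mul_le_mul w11 w10 (norm_nonneg _) hr0.le
  · refine (norm_add_mul_le (s := r) (t := r) ?_ ?_).trans (max_le le_rfl le_rfl)
    · exact (mul_le_mul w10 w01 (norm_nonneg _) hr0.le).trans (mul_one r).le
    · exact (mul_le_mul w11 w11 (norm_nonneg _) hr0.le).trans hrr

/-- **`p^{-e} W²` is level-shaped** for an Atkin–Lehner-shaped `W` (`w² ∈ p^e O_p`). [cite: VignerasLNM800, Ch. II §2] -/
theorem isLevelShape_inv_smul_mul_self {W : Matrix (Fin 2) (Fin 2) ℚ_[p]} (hW : IsALShape e W) :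
    IsLevelShape e ((((p ^ e : ℕ) : ℚ_[p]))⁻¹ • (W * W)) := by
  set r := (p : ℝ) ^ (-(e : ℤ))
  have hr0 := zpow_neg_pos (p := p) e
  have hri : r⁻¹ * r = 1 := inv_mul_cancel₀ hr0.ne'
  obtain ⟨h00, h01, h10, h11⟩ := norm_mul_self_apply_le hW
  have key : ∀ i j, ‖((((p ^ e : ℕ) : ℚ_[p]))⁻¹ • (W * W)) i j‖ = r⁻¹ * ‖(W * W) i j‖ := fun i j => by
    rw [Matrix.smul_apply, smul_eq_mul, norm_mul, norm_inv, norm_natCast_pow]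
  refine ⟨fun i j => ?_, ?_⟩
  · rw [key]
    fin_cases i <;> fin_cases j
    · calc r⁻¹ * ‖(W * W) 0 0‖ ≤ r⁻¹ * r := by gcongr
        _ = 1 := hri
    · calc r⁻¹ * ‖(W * W) 0 1‖ ≤ r⁻¹ * r := by gcongr
        _ = 1 := hri
    · calc r⁻¹ * ‖(W * W) 1 0‖ ≤ r⁻¹ * (r * r) := by gcongr
        _ = 1 * r := by rw [← mul_assoc, hri]
        _ ≤ 1 := by rw [one_mul]; exact zpow_neg_le_one e
    · calc r⁻¹ * ‖(W * W) 1 1‖ ≤ r⁻¹ * r := by gcongr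
        _ = 1 := hri
  · rw [key]
    calc r⁻¹ * ‖(W * W) 1 0‖ ≤ r⁻¹ * (r * r) := by gcongr
      _ = r := by rw [← mul_assoc, hri, one_mul]

/-- **`p^e W⁻²` is level-shaped** for an Atkin–Lehner-shaped `W` with `‖det W‖ = p^{-e}`
(`p^e ∈ w² O_p`; together with the previous lemma, `w² O_p = p^e O_p`). [cite: VignerasLNM800, Ch. II §2] -/
theorem isLevelShape_smul_mul_self_inv {W : Matrix (Fin 2) (Fin 2) ℚ_[p]} (hW : IsALShape e W)
    (hdet : ‖W.det‖ = (p : ℝ) ^ (-(e : ℤ))) :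
    IsLevelShape e ((((p ^ e : ℕ) : ℚ_[p])) • (W * W)⁻¹) := by
  set r := (p : ℝ) ^ (-(e : ℤ))
  have hr0 := zpow_neg_pos (p := p) e
  have hri : r⁻¹ * r = 1 := inv_mul_cancel₀ hr0.ne'
  obtain ⟨h00, h01, h10, h11⟩ := norm_mul_self_apply_le hW
  have hdet2 : ‖(W * W).det‖ = r * r := by rw [Matrix.det_mul, norm_mul, hdet]
  have key : ∀ i j, ‖((((p ^ e : ℕ) : ℚ_[p])) • (W * W)⁻¹) i j‖ = r⁻¹ * ‖(W * W).adjugate i j‖ := fun i j => by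
    rw [Matrix.inv_def, Ring.inverse_eq_inv', smul_smul, Matrix.smul_apply, smul_eq_mul, norm_mul, norm_mul,
      norm_inv, hdet2, norm_natCast_pow, mul_inv, ← mul_assoc, mul_inv_cancel₀ hr0.ne', one_mul]
  have hadj : ∀ i j, (W * W).adjugate i j = !![(W * W) 1 1, -(W * W) 0 1; -(W * W) 1 0, (W * W) 0 0] i j :=
    fun i j => by rw [Matrix.adjugate_fin_two]
  refine ⟨fun i j => ?_, ?_⟩
  · rw [key, hadj]
    fin_cases i <;> fin_cases j
    · simp only [Fin.zero_eta, Fin.isValue, Matrix.of_apply, Matrix.cons_val', Matrix.cons_val_zero,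
        Matrix.empty_val']
      calc r⁻¹ * ‖(W * W) 1 1‖ ≤ r⁻¹ * r := by gcongr
        _ = 1 := hri
    · simp only [Fin.zero_eta, Fin.mk_one, Fin.isValue, Matrix.of_apply, Matrix.cons_val', Matrix.cons_val_one,
        Matrix.cons_val_fin_one, Matrix.cons_val_zero, Matrix.empty_val', norm_neg]
      calc r⁻¹ * ‖(W * W) 0 1‖ ≤ r⁻¹ * r := by gcongr
        _ = 1 := hri
    · simp only [Fin.mk_one, Fin.zero_eta, Fin.isValue, Matrix.of_apply, Matrix.cons_val', Matrix.cons_val_zero,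
        Matrix.cons_val_one, Matrix.cons_val_fin_one, Matrix.empty_val', norm_neg]
      calc r⁻¹ * ‖(W * W) 1 0‖ ≤ r⁻¹ * (r * r) := by gcongr
        _ = 1 * r := by rw [← mul_assoc, hri]
        _ ≤ 1 := by rw [one_mul]; exact zpow_neg_le_one e
    · simp only [Fin.mk_one, Fin.isValue, Matrix.of_apply, Matrix.cons_val', Matrix.cons_val_one,
        Matrix.cons_val_fin_one, Matrix.empty_val']
      calc r⁻¹ * ‖(W * W) 0 0‖ ≤ r⁻¹ * r := by gcongr
        _ = 1 := hri
  · rw [key, hadj]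
    simp only [Fin.isValue, Matrix.of_apply, Matrix.cons_val', Matrix.cons_val_zero, Matrix.cons_val_one,
      Matrix.cons_val_fin_one, Matrix.empty_val', norm_neg]
    calc r⁻¹ * ‖(W * W) 1 0‖ ≤ r⁻¹ * (r * r) := by gcongr
      _ = r := by rw [← mul_assoc, hri, one_mul]

end AtkinLehner

/-! ### §3 The local structure at `p`: `(𝔔_{p^e})_(p) = Φ⁻¹(p^e ℤ_p, ℤ_p; p^e ℤ_p, p^e ℤ_p) = w O_(p)` -/

section Local

open AtkinLehner

variable {p : ℕ} [hp : Fact p.Prime] {e : ℕ} (Φ : B →ₐ[ℚ] Matrix (Fin 2) (Fin 2) ℚ_[p])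
  (hO : IsZOrder O) (hΦ : ∀ y : B, y ∈ localAt p O ↔ IsLevelShape e (Φ y))

/-- `trd(x y) = tr(Φ(x) Φ(y))` in `ℚ_p`. [cite: VignerasLNM800, Ch. I §1 Lemme 1.1] -/
theorem ratCast_reducedTrace_mul (x y : B) :
    ((reducedTrace ℚ B (x * y) : ℚ) : ℚ_[p]) = (Φ x * Φ y).trace := by
  rw [← map_mul, AlgHom.trace_eq_reducedTrace]; rfl

omit [IsQuaternionAlgebra ℚ B] in
/-- `‖tr(M N)‖ ≤ t` when the entries of `M` are integral and those of `N` are bounded by `t`. [folklore] -/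
private theorem norm_trace_mul_le_of_le {M N : Matrix (Fin 2) (Fin 2) ℚ_[p]} {t : ℝ} (hM : ∀ i j, ‖M i j‖ ≤ 1)
    (hN : ∀ i j, ‖N i j‖ ≤ t) : ‖(M * N).trace‖ ≤ t := by
  have ht : 0 ≤ t := (norm_nonneg _).trans (hN 0 0)
  rw [Matrix.trace_fin_two, Matrix.mul_apply, Matrix.mul_apply, Fin.sum_univ_two, Fin.sum_univ_two]
  refine (Padic.nonarchimedean _ _).trans (max_le ?_ ?_) <;>
    refine (norm_add_mul_le (s := t) (t := t) ?_ ?_).trans (max_le le_rfl le_rfl) <;>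
    exact (mul_le_mul (hM _ _) (hN _ _) (norm_nonneg _) zero_le_one).trans (one_mul t).le

include hΦ in
/-- **The trace test on a diagonal entry**: if `Φ(x)` is integral and `‖trd(x y)‖_p ≤ p^{-e}` for all
`y ∈ O_(p)`, then `‖Φ(x)_{ii}‖ ≤ p^{-e}` — test against `y` with `Φ(y) ≡ E_{ii} (mod p^e)` (density of
`Φ(B)`; such `y` lies in `O_(p)` as `E_{ii}` is in the level-`p^e` order). [cite: VignerasLNM800, Ch. I §4 Lemme 4.7] -/
theorem norm_apply_diag_le_of_trace_test {x : B} (hint : ∀ i j, ‖Φ x i j‖ ≤ 1) (i : Fin 2)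
    (htest : ∀ y ∈ localAt p O, ‖(Φ x * Φ y).trace‖ ≤ (p : ℝ) ^ (-(e : ℤ))) :
    ‖Φ x i i‖ ≤ (p : ℝ) ^ (-(e : ℤ)) := by
  set r := (p : ℝ) ^ (-(e : ℤ))
  have hr1 := zpow_neg_le_one (p := p) e
  obtain ⟨y, hy⟩ := AlgHom.exists_norm_sub_le Φ (Matrix.single i i (1 : ℚ_[p])) e
  set Δ := Φ y - Matrix.single i i (1 : ℚ_[p]) with hΔ
  have hΦy : Φ y = Matrix.single i i (1 : ℚ_[p]) + Δ := by rw [hΔ]; abel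
  have hyO : y ∈ localAt p O := by
    rw [hΦ]
    refine ⟨fun k l => ?_, ?_⟩
    · rw [hΦy, Matrix.add_apply]
      refine (Padic.nonarchimedean _ _).trans (max_le ?_ ((hy k l).trans hr1))
      rw [Matrix.single_apply]
      split_ifs <;> simp
    · rw [hΦy, Matrix.add_apply, Matrix.single_apply, if_neg, zero_add]
      · exact hy 1 0
      · rintro ⟨h1, h0⟩
        fin_cases i
        · exact absurd h1 (by decide)
        · exact absurd h0 (by decide)
  have htr : (Φ x * Φ y).trace = Φ x i i + (Φ x * Δ).trace := by
    rw [hΦy, mul_add, Matrix.trace_add, Matrix.trace_mul_single_fin_two]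
  have herr : ‖(Φ x * Δ).trace‖ ≤ r := norm_trace_mul_le_of_le hint hy
  have e1 : Φ x i i = (Φ x * Φ y).trace - (Φ x * Δ).trace := by rw [htr]; ring
  rw [e1, sub_eq_add_neg]
  exact (Padic.nonarchimedean _ _).trans (max_le (htest y hyO) (by rw [norm_neg]; exact herr))

include hΦ in
/-- **`(𝔔_{p^e})_(p) ⊆ Φ⁻¹(p^e, 1; p^e, p^e)`**: an element of the localised Atkin–Lehner ideal has
Atkin–Lehner shape (the trace test above on the two diagonal entries; the entry `(1,0)` is already in
`p^e ℤ_p` for elements of `O_(p)`). [cite: VignerasLNM800, Ch. I §4 Lemme 4.7, Ch. II §2] -/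
theorem isALShape_of_mem_localAt {x : B} (hx : x ∈ localAt p (atkinLehnerIdeal O (p ^ e))) :
    IsALShape e (Φ x) := by
  set r := (p : ℝ) ^ (-(e : ℤ))
  obtain ⟨k, hk0, hkp, hkx⟩ := hx
  have hxO : x ∈ localAt p O := ⟨k, hk0, hkp, hkx.1⟩
  obtain ⟨hint, h10⟩ := (hΦ x).mp hxO
  have hk1 : ‖(k : ℚ_[p])‖ = 1 := Padic.norm_natCast_eq_one_of_coprime hkp
  have htest : ∀ y ∈ localAt p O, ‖(Φ x * Φ y).trace‖ ≤ r := by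
    intro y hy
    obtain ⟨k', hk0', hkp', hky⟩ := hy
    have hk1' : ‖(k' : ℚ_[p])‖ = 1 := Padic.norm_natCast_eq_one_of_coprime hkp'
    obtain ⟨n, hn⟩ := hkx.2 _ hky
    have e1 : reducedTrace ℚ B (((k : ℤ) • x) * ((k' : ℤ) • y)) = ((k : ℚ) * k') * reducedTrace ℚ B (x * y) := by
      rw [smul_mul_assoc, mul_smul_comm, map_zsmul, map_zsmul, smul_smul, zsmul_eq_mul]
      push_cast; ring
    have e2 : ((k : ℚ_[p]) * k') * (Φ x * Φ y).trace = ((p ^ e : ℕ) : ℚ_[p]) * (n : ℚ_[p]) := by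
      rw [← ratCast_reducedTrace_mul Φ]
      have h := congrArg (fun q : ℚ => (q : ℚ_[p])) (e1.symm.trans hn)
      simpa using h
    have h3 : ‖((k : ℚ_[p]) * k') * (Φ x * Φ y).trace‖ ≤ r := by
      rw [e2, norm_mul, norm_natCast_pow]
      exact (mul_le_mul_of_nonneg_left (Padic.norm_int_le_one n) (zpow_neg_pos e).le).trans (mul_one r).le
    rwa [norm_mul, norm_mul, hk1, hk1', one_mul, one_mul] at h3
  exact ⟨norm_apply_diag_le_of_trace_test Φ hΦ hint 0 htest, hint 0 1, h10,
    norm_apply_diag_le_of_trace_test Φ hΦ hint 1 htest⟩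

include hO hΦ in
/-- **`Φ⁻¹(p^e, 1; p^e, p^e) ⊆ (𝔔_{p^e})_(p)`**: an `x` of Atkin–Lehner shape lies in `O_(p)`, say
`k x ∈ O` with `p ∤ k`, and then `k x ∈ 𝔔_{p^e}`: for `y ∈ O` the integer `trd(k x y)` has
`‖·‖_p ≤ p^{-e}`, i.e. is divisible by `p^e`. [cite: VignerasLNM800, Ch. I §4 Lemme 4.7, Ch. II §2] -/
theorem mem_localAt_of_isALShape {x : B} (hx : IsALShape e (Φ x)) :
    x ∈ localAt p (atkinLehnerIdeal O (p ^ e)) := by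
  obtain ⟨k, hk0, hkp, hkx⟩ := (hΦ x).mpr hx.isLevelShape
  refine ⟨k, hk0, hkp, hkx, fun y hy => ?_⟩
  obtain ⟨t, -, ht, -⟩ := hO.toIsOrder.exists_int_reducedTrace_reducedNorm (hO.mul_mem _ hkx _ hy)
  have hyshape : IsLevelShape e (Φ y) := (hΦ y).mp (le_localAt p O hy)
  have hnorm : ‖(t : ℚ_[p])‖ ≤ (p : ℝ) ^ (-(e : ℤ)) := by
    have e1 : ((t : ℚ) : ℚ_[p]) = (k : ℚ_[p]) * (Φ x * Φ y).trace := by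
      rw [← ht, smul_mul_assoc, map_zsmul, zsmul_eq_mul, Rat.cast_mul, ratCast_reducedTrace_mul Φ]
      simp
    have h : ‖((t : ℚ) : ℚ_[p])‖ ≤ (p : ℝ) ^ (-(e : ℤ)) := by
      rw [e1, norm_mul, Padic.norm_natCast_eq_one_of_coprime hkp, one_mul]
      exact norm_trace_mul_le hx hyshape
    simpa using h
  obtain ⟨n, hn⟩ := (Padic.norm_int_le_pow_iff_dvd t e).mp hnorm
  exact ⟨n, by rw [ht, hn]; push_cast; ring⟩

include hO hΦ in
/-- **The localised Atkin–Lehner ideal in the matrix model**: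
`x ∈ (𝔔_{p^e})_(p) ↔ Φ(x) ∈ (p^e ℤ_p, ℤ_p; p^e ℤ_p, p^e ℤ_p)` for a level-`p^e` model
`O_(p) = Φ⁻¹(ℤ_p, ℤ_p; p^e ℤ_p, ℤ_p)`. [cite: VignerasLNM800, Ch. II §2 (ordres d'Eichler, normalisateur)] -/
theorem mem_localAt_atkinLehnerIdeal_iff (x : B) :
    x ∈ localAt p (atkinLehnerIdeal O (p ^ e)) ↔ IsALShape e (Φ x) :=
  ⟨isALShape_of_mem_localAt Φ hΦ, mem_localAt_of_isALShape Φ hO hΦ⟩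

omit [IsQuaternionAlgebra ℚ B] in
/-- Scaling by a `p`-adic unit preserves the Atkin–Lehner shape. [folklore] -/
private theorem AtkinLehner.IsALShape.smul {M : Matrix (Fin 2) (Fin 2) ℚ_[p]} (h : IsALShape e M) {c : ℚ_[p]}
    (hc : ‖c‖ ≤ 1) : IsALShape e (c • M) := by
  obtain ⟨h00, h01, h10, h11⟩ := h
  refine ⟨?_, ?_, ?_, ?_⟩ <;> rw [Matrix.smul_apply, smul_eq_mul, norm_mul]
  · exact (mul_le_mul hc h00 (norm_nonneg _) zero_le_one).trans (one_mul _).le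
  · exact mul_le_one₀ hc (norm_nonneg _) h01
  · exact (mul_le_mul hc h10 (norm_nonneg _) zero_le_one).trans (one_mul _).le
  · exact (mul_le_mul hc h11 (norm_nonneg _) zero_le_one).trans (one_mul _).le

include hO hΦ in
/-- **An Atkin–Lehner element exists**: there is `w ∈ 𝔔_{p^e}`, a unit of `B`, with `Φ(w)` of
Atkin–Lehner shape and `‖det Φ(w)‖_p = ‖nrd w‖_p = p^{-e}` — a rational approximation
`Φ(w) ≡ k · (0 1; p^e 0) (mod p^{e+1})`, `p ∤ k`, of the local Atkin–Lehner element (density of `Φ(B)`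
in `M₂(ℚ_p)`). [cite: VignerasLNM800, Ch. II §2 (normalisateur d'un ordre d'Eichler)] -/
theorem exists_atkinLehner_generator (hdiv : ∀ x : B, x ≠ 0 → IsUnit x) :
    ∃ w : Bˣ, (w : B) ∈ atkinLehnerIdeal O (p ^ e) ∧ IsALShape e (Φ w) ∧
      ‖(Φ (w : B)).det‖ = (p : ℝ) ^ (-(e : ℤ)) := by
  set r := (p : ℝ) ^ (-(e : ℤ))
  have hr0 := zpow_neg_pos (p := p) e
  have hr1 := zpow_neg_le_one (p := p) e
  have hp1 : (1 : ℝ) < p := by exact_mod_cast hp.out.one_lt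
  set A₀ : Matrix (Fin 2) (Fin 2) ℚ_[p] := !![0, 1; ((p ^ e : ℕ) : ℚ_[p]), 0] with hA₀
  obtain ⟨w₀, hw₀⟩ := AlgHom.exists_norm_sub_le Φ A₀ (e + 1)
  set Δ := Φ w₀ - A₀ with hΔ
  have hΦw₀ : Φ w₀ = A₀ + Δ := by rw [hΔ]; abel
  have hδ : ∀ i j, ‖Δ i j‖ < r := fun i j => lt_of_le_of_lt (hw₀ i j)
    (zpow_lt_zpow_right₀ hp1 (by push_cast; omega))
  have h00 : Φ w₀ 0 0 = Δ 0 0 := by rw [hΦw₀, Matrix.add_apply]; simp [A₀]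
  have h01 : Φ w₀ 0 1 = 1 + Δ 0 1 := by rw [hΦw₀, Matrix.add_apply]; simp [A₀]
  have h10 : Φ w₀ 1 0 = ((p ^ e : ℕ) : ℚ_[p]) + Δ 1 0 := by rw [hΦw₀, Matrix.add_apply]; simp [A₀]
  have h11 : Φ w₀ 1 1 = Δ 1 1 := by rw [hΦw₀, Matrix.add_apply]; simp [A₀]
  have hn01 : ‖Φ w₀ 0 1‖ = 1 := by
    rw [h01, Padic.add_eq_max_of_ne (by rw [norm_one]; exact ((hδ 0 1).trans_le hr1).ne'), norm_one]
    exact max_eq_left ((hδ 0 1).le.trans hr1)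
  have hn10 : ‖Φ w₀ 1 0‖ = r := by
    rw [h10, Padic.add_eq_max_of_ne (by rw [norm_natCast_pow]; exact (hδ 1 0).ne'), norm_natCast_pow]
    exact max_eq_left (hδ 1 0).le
  have hshape : IsALShape e (Φ w₀) :=
    ⟨by rw [h00]; exact (hδ 0 0).le, hn01.le, hn10.le, by rw [h11]; exact (hδ 1 1).le⟩
  have hdet : ‖(Φ w₀).det‖ = r := by
    rw [Matrix.det_fin_two, sub_eq_add_neg, add_comm, Padic.add_eq_max_of_ne, norm_neg, norm_mul, hn01, hn10,
      one_mul]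
    · refine max_eq_left ?_
      rw [norm_mul, h00, h11]
      exact ((mul_le_of_le_one_right (norm_nonneg _) ((hδ 1 1).le.trans hr1)).trans_lt (hδ 0 0)).le
    · rw [norm_neg, norm_mul, hn01, hn10, one_mul, norm_mul, h00, h11]
      exact ((mul_le_of_le_one_right (norm_nonneg _) ((hδ 1 1).le.trans hr1)).trans_lt (hδ 0 0)).ne'
  -- globalise: `k w₀ ∈ 𝔔` with `p ∤ k`
  obtain ⟨k, hk0, hkp, hk⟩ := mem_localAt_of_isALShape Φ hO hΦ hshape
  have hk1 : ‖(k : ℚ_[p])‖ = 1 := Padic.norm_natCast_eq_one_of_coprime hkp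
  have hΦk : Φ ((k : ℤ) • w₀) = (k : ℚ_[p]) • Φ w₀ := by
    rw [map_zsmul, ← Int.cast_smul_eq_zsmul ℚ_[p], Int.cast_natCast]
  have hne : (k : ℤ) • w₀ ≠ 0 := by
    intro h0
    have h := congrArg (fun z => ‖Φ z 0 1‖) h0
    simp only [hΦk, Matrix.smul_apply, smul_eq_mul, norm_mul, hk1, hn01, one_mul, map_zero,
      Matrix.zero_apply, norm_zero] at h
    exact one_ne_zero h
  refine ⟨(hdiv _ hne).unit, by rw [IsUnit.unit_spec]; exact hk, ?_, ?_⟩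
  · rw [IsUnit.unit_spec, hΦk]; exact hshape.smul hk1.le
  · rw [IsUnit.unit_spec, hΦk, Matrix.det_smul, norm_mul, norm_pow, hk1, one_pow, one_mul, hdet]

omit [IsQuaternionAlgebra ℚ B] in
/-- `Φ(w⁻¹) = Φ(w)⁻¹` for a unit `w`. [folklore] -/
private theorem map_units_inv (w : Bˣ) : Φ ((w⁻¹ : Bˣ) : B) = (Φ (w : B))⁻¹ :=
  (Matrix.inv_eq_left_inv (by rw [← map_mul, Units.inv_mul, map_one])).symm

include hO hΦ in
/-- **`(𝔔_{p^e})_(p) = w O_(p)` is locally principal**, generated by any Atkin–Lehner element `w`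
(`w ∈ 𝔔_{p^e}`, `Φ(w)` of Atkin–Lehner shape, `‖nrd w‖_p = p^{-e}`). [cite: VignerasLNM800, Ch. II §2 (normalisateur d'un ordre d'Eichler)] -/
theorem localAt_atkinLehnerIdeal_eq_units_smul {w : Bˣ} (hw : (w : B) ∈ atkinLehnerIdeal O (p ^ e))
    (hW : IsALShape e (Φ w)) (hdet : ‖(Φ (w : B)).det‖ = (p : ℝ) ^ (-(e : ℤ))) :
    localAt p (atkinLehnerIdeal O (p ^ e)) = w • localAt p O := by
  refine le_antisymm (fun x hx => ?_) (fun x hx => ?_)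
  · rw [mem_units_smul_submodule_iff, hΦ, Units.smul_def, smul_eq_mul, map_mul, map_units_inv]
    exact isLevelShape_inv_mul hW hdet (isALShape_of_mem_localAt Φ hΦ hx)
  · obtain ⟨o, ho, rfl⟩ := (Submodule.mem_smul_pointwise_iff_exists x w _).mp hx
    rw [Units.smul_def, smul_eq_mul]
    exact mul_mem_localAt_of_mul_mem (fun a ha b hb => mul_mem_atkinLehnerIdeal_right hO ha hb)
      (le_localAt p _ hw) ho

omit [Algebra ℚ B] [IsQuaternionAlgebra ℚ B] hp in
include hO in
/-- A unit `u` with `u, u⁻¹ ∈ O_(p)` stabilises `O_(p)`: `u O_(p) = O_(p)`. [folklore] -/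
private theorem units_smul_localAt_eq_of_mem {u : Bˣ} (hu : (u : B) ∈ localAt p O) (hu' : ((u⁻¹ : Bˣ) : B) ∈ localAt p O) :
    u • localAt p O = localAt p O := by
  refine le_antisymm (fun x hx => ?_) (fun x hx => ?_)
  · obtain ⟨o, ho, rfl⟩ := (Submodule.mem_smul_pointwise_iff_exists x u _).mp hx
    rw [Units.smul_def, smul_eq_mul]
    exact hO.mul_mem_localAt hu ho
  · rw [mem_units_smul_submodule_iff, Units.smul_def, smul_eq_mul]
    exact hO.mul_mem_localAt hu' hx

omit [IsQuaternionAlgebra ℚ B] in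
include hO hΦ in
/-- **`w² O_(p) = p^e O_(p)`** for an Atkin–Lehner element `w` (`p^{-e} w²` is a unit of `O_(p)`:
both `p^{-e} Φ(w)²` and `p^e Φ(w)⁻²` are in the level-`p^e` order). Here `ν = p^e · 1 ∈ Bˣ`. [cite: VignerasLNM800, Ch. II §2 (normalisateur d'un ordre d'Eichler)] -/
theorem mul_self_smul_localAt_eq {w : Bˣ} (hW : IsALShape e (Φ w))
    (hdet : ‖(Φ (w : B)).det‖ = (p : ℝ) ^ (-(e : ℤ))) {ν : Bˣ} (hν : (ν : B) = ((p ^ e : ℕ) : ℤ)) :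
    (w * w) • localAt p O = ν • localAt p O := by
  have hΦν : Φ (ν : B) = ((p ^ e : ℕ) : ℚ_[p]) • (1 : Matrix (Fin 2) (Fin 2) ℚ_[p]) := by
    rw [hν, Int.cast_natCast, map_natCast, ← map_natCast (algebraMap ℚ_[p] (Matrix (Fin 2) (Fin 2) ℚ_[p])),
      Algebra.algebraMap_eq_smul_one]
  have hν0 : ((p ^ e : ℕ) : ℚ_[p]) ≠ 0 := by exact_mod_cast pow_ne_zero e hp.out.ne_zero
  have hΦνi : Φ ((ν⁻¹ : Bˣ) : B) = (((p ^ e : ℕ) : ℚ_[p]))⁻¹ • (1 : Matrix (Fin 2) (Fin 2) ℚ_[p]) := by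
    rw [map_units_inv, hΦν]
    refine Matrix.inv_eq_left_inv ?_
    rw [Matrix.smul_mul, Matrix.mul_smul, one_mul, smul_smul, inv_mul_cancel₀ hν0, one_smul]
  set u : Bˣ := ν⁻¹ * (w * w) with hu
  have hu1 : (u : B) ∈ localAt p O := by
    rw [hΦ, hu, Units.val_mul, Units.val_mul, map_mul, map_mul, hΦνi, smul_mul_assoc, one_mul]
    exact isLevelShape_inv_smul_mul_self hW
  have hu2 : ((u⁻¹ : Bˣ) : B) ∈ localAt p O := by
    rw [hΦ, hu, mul_inv_rev, inv_inv, Units.val_mul, map_mul, map_units_inv, Units.val_mul, map_mul, hΦν,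
      Matrix.mul_smul, mul_one]
    exact isLevelShape_smul_mul_self_inv hW hdet
  have e1 : w * w = ν * u := by rw [hu, mul_inv_cancel_left]
  rw [e1, mul_smul, units_smul_localAt_eq_of_mem hO hu1 hu2]

include hO hΦ in
/-- **At `p`: if `I_(p) = β O_(p)` then `(I 𝔔_{p^e})_(p) = (β w) O_(p)`** for an Atkin–Lehner element
`w`. [cite: VignerasLNM800, Ch. II §2] -/
theorem localAt_mul_atkinLehnerIdeal_self {I : Submodule ℤ B} {β : Bˣ} (hβ : localAt p I = β • localAt p O)
    {w : Bˣ} (hw : (w : B) ∈ atkinLehnerIdeal O (p ^ e)) (hW : IsALShape e (Φ w))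
    (hdet : ‖(Φ (w : B)).det‖ = (p : ℝ) ^ (-(e : ℤ))) :
    localAt p (I * atkinLehnerIdeal O (p ^ e)) = (β * w) • localAt p O := by
  rw [← localAt_mul_localAt_eq, hβ, localAt_atkinLehnerIdeal_eq_units_smul Φ hO hΦ hw hW hdet,
    smul_mul_assoc, mul_smul]
  congr 1
  refine le_antisymm (Submodule.mul_le.mpr fun a ha x hx => ?_) fun x hx => ?_
  · rw [← localAt_atkinLehnerIdeal_eq_units_smul Φ hO hΦ hw hW hdet] at hx ⊢
    have h : localAt p O * localAt p (atkinLehnerIdeal O (p ^ e)) ≤ localAt p (atkinLehnerIdeal O (p ^ e)) := by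
      rw [localAt_mul_localAt_eq, order_mul_atkinLehnerIdeal hO]
    exact h (Submodule.mul_mem_mul ha hx)
  · rw [← one_mul x]
    exact Submodule.mul_mem_mul (le_localAt p O hO.one_mem) hx

include hO hΦ in
/-- **`I 𝔔_{p^e}` is an invertible right `O`-ideal** for every invertible right `O`-ideal `I`
(locally principal everywhere: `β w` at `p`, the generator of `I` at `q ≠ p`). [cite: VignerasLNM800, Ch. II §2, Ch. III §5] -/
theorem isInvertibleRightIdeal_mul_atkinLehnerIdeal (hdiv : ∀ x : B, x ≠ 0 → IsUnit x)
    {I : Submodule ℤ B} (hI : IsInvertibleRightIdeal O I) :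
    IsInvertibleRightIdeal O (I * atkinLehnerIdeal O (p ^ e)) := by
  have hm : p ^ e ≠ 0 := pow_ne_zero e hp.out.ne_zero
  have hPfg : (atkinLehnerIdeal O (p ^ e)).FG :=
    Submodule.FG.of_le hO.isFullLattice.1 (atkinLehnerIdeal_le O (p ^ e))
  have hfull : IsFullLattice B (I * atkinLehnerIdeal O (p ^ e)) := by
    refine ⟨hI.isFullLattice.1.mul hPfg, fun d => ?_⟩
    obtain ⟨n, hn, hnd⟩ := hI.isFullLattice.2 d
    refine ⟨(p ^ e : ℕ) * n, mul_ne_zero (by exact_mod_cast hm) hn, ?_⟩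
    rw [mul_smul]
    exact smul_le_mul_atkinLehnerIdeal hO I (Submodule.smul_mem_pointwise_smul _ _ I hnd)
  obtain ⟨w, hw, hW, hdet⟩ := exists_atkinLehner_generator Φ hO hΦ hdiv
  refine IsInvertibleRightIdeal.of_forall_localAt_eq_units_smul hO hfull fun q hq => ?_
  haveI : Fact q.Prime := ⟨hq⟩
  by_cases hqp : q = p
  · subst hqp
    obtain ⟨β, -, hβ⟩ := hI.exists_localAt_eq_units_smul hdiv hO q
    exact ⟨β * w, localAt_mul_atkinLehnerIdeal_self Φ hO hΦ hβ hw hW hdet⟩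
  · obtain ⟨β, -, hβ⟩ := hI.exists_localAt_eq_units_smul hdiv hO q
    exact ⟨β, by rw [localAt_mul_atkinLehnerIdeal_of_coprime hO hm hI
      (Nat.Coprime.pow_left e ((Nat.coprime_primes hp.out hq).mpr (Ne.symm hqp))), hβ]⟩

include hO hΦ in
/-- **`I 𝔔_{p^e} 𝔔_{p^e} = p^e I`** for every invertible right `O`-ideal `I` (locally: `β w² O_(p) =
β p^e O_(p)` at `p`, and `I_(q)` on both sides at `q ≠ p`): the Atkin–Lehner ideal is an involution on
ideal classes, `𝔔² = p^e O`. [cite: VignerasLNM800, Ch. II §2 (normalisateur), Ch. III §5] -/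
theorem mul_atkinLehnerIdeal_mul_atkinLehnerIdeal (hdiv : ∀ x : B, x ≠ 0 → IsUnit x)
    {I : Submodule ℤ B} (hI : IsInvertibleRightIdeal O I) :
    I * atkinLehnerIdeal O (p ^ e) * atkinLehnerIdeal O (p ^ e) = ((p ^ e : ℕ) : ℤ) • I := by
  have hm : p ^ e ≠ 0 := pow_ne_zero e hp.out.ne_zero
  obtain ⟨ν, hν, hνc⟩ := Brandt.exists_units_val_eq_natCast (D := B) hm
  have hνI : ((p ^ e : ℕ) : ℤ) • I = ν • I := by
    ext x
    constructor
    · intro hx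
      obtain ⟨y, hy, rfl⟩ := (Submodule.mem_smul_pointwise_iff_exists x _ I).mp hx
      exact Brandt.units_smul_eq_zsmul_of_val_eq hν I hy
    · intro hx
      obtain ⟨y, hy, rfl⟩ := Brandt.exists_eq_zsmul_of_mem_units_smul hν hx
      exact Submodule.smul_mem_pointwise_smul y _ I hy
  obtain ⟨w, hw, hW, hdet⟩ := exists_atkinLehner_generator Φ hO hΦ hdiv
  have hIQ := isInvertibleRightIdeal_mul_atkinLehnerIdeal Φ hO hΦ hdiv hI
  refine eq_iff_forall_prime_localAt_eq.mpr fun q hq => ?_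
  haveI : Fact q.Prime := ⟨hq⟩
  by_cases hqp : q = p
  · subst hqp
    obtain ⟨β, -, hβ⟩ := hI.exists_localAt_eq_units_smul hdiv hO q
    have h1 := localAt_mul_atkinLehnerIdeal_self Φ hO hΦ hβ hw hW hdet
    have h2 := localAt_mul_atkinLehnerIdeal_self Φ hO hΦ h1 hw hW hdet
    rw [h2, mul_assoc, mul_smul, mul_self_smul_localAt_eq Φ hO hΦ hW hdet hν, ← mul_smul, hνc β, mul_smul,
      ← hβ, ← localAt_units_smul, hνI]
  · have hcop : (p ^ e).Coprime q := Nat.Coprime.pow_left e ((Nat.coprime_primes hp.out hq).mpr (Ne.symm hqp))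
    rw [localAt_mul_atkinLehnerIdeal_of_coprime hO hm hIQ hcop, localAt_mul_atkinLehnerIdeal_of_coprime hO hm hI hcop]
    refine localAt_eq_of_smul_le (fun x hx => ?_) hm hcop fun x hx => Submodule.smul_mem_pointwise_smul x _ I hx
    obtain ⟨y, hy, rfl⟩ := (Submodule.mem_smul_pointwise_iff_exists x _ I).mp hx
    exact I.smul_mem _ hy

end Local

/-! ### §4 Two-sided ideals commute; no split torus commutes with an Atkin–Lehner generator -/

section Commute

omit [IsQuaternionAlgebra ℚ B] in
/-- **Two-sided ideals of `O` which are locally trivial at complementary primes commute**: if at every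
prime `q` one of `J_(q)`, `J'_(q)` equals `O_(q)`, then `J J' = J' J` (both localise to the other
factor). [cite: VignerasLNM800, Ch. I §4 Théorème 4.5 (proof) and Ch. III §5] -/
theorem mul_comm_of_forall_localAt {J J' : Submodule ℤ B} (hJl : O * J = J) (hJr : J * O = J)
    (hJ'l : O * J' = J') (hJ'r : J' * O = J')
    (h : ∀ q : ℕ, q.Prime → localAt q J = localAt q O ∨ localAt q J' = localAt q O) : J * J' = J' * J := by
  refine eq_iff_forall_prime_localAt_eq.mpr fun q hq => ?_
  rw [← localAt_mul_localAt_eq, ← localAt_mul_localAt_eq q J']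
  rcases h q hq with hq' | hq'
  · rw [hq', localAt_mul_localAt_eq, localAt_mul_localAt_eq, hJ'l, hJ'r]
  · rw [hq', localAt_mul_localAt_eq, localAt_mul_localAt_eq, hJr, hJl]

/-- **`𝔔_m 𝔔_{m'} = 𝔔_{m'} 𝔔_m` for coprime `m, m'`** (the Atkin–Lehner ideals commute). [cite: VignerasLNM800, Ch. III §5] -/
theorem atkinLehnerIdeal_mul_atkinLehnerIdeal_comm (hO : IsZOrder O) {m m' : ℕ} (hm : m ≠ 0) (hm' : m' ≠ 0)
    (hmm' : m.Coprime m') :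
    atkinLehnerIdeal O m * atkinLehnerIdeal O m' = atkinLehnerIdeal O m' * atkinLehnerIdeal O m :=
  mul_comm_of_forall_localAt (order_mul_atkinLehnerIdeal hO) (atkinLehnerIdeal_mul_order hO)
    (order_mul_atkinLehnerIdeal hO) (atkinLehnerIdeal_mul_order hO) fun q hq => by
    by_cases hqm : q ∣ m
    · right
      refine localAt_atkinLehnerIdeal_of_coprime hO hm' ((Nat.Prime.coprime_iff_not_dvd hq).mpr fun h => ?_).symm
      exact hq.one_lt.ne' (Nat.dvd_one.mp (hmm'.gcd_eq_one ▸ Nat.dvd_gcd hqm h))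
    · left
      exact localAt_atkinLehnerIdeal_of_coprime hO hm ((Nat.Prime.coprime_iff_not_dvd hq).mpr hqm).symm

/-- **`𝔔_m 𝔓_q = 𝔓_q 𝔔_m`** for a prime `q ∤ m` and the prime `𝔓_q = normPrimeIdeal O q` of `O` above a
prime `q` (used for `q` ramified): the Atkin–Lehner ideals commute with the ramified primes. [cite: VignerasLNM800, Ch. III §5 exercice 5.8] -/
theorem atkinLehnerIdeal_mul_normPrimeIdeal_comm (hO : IsZOrder O) (hm : m ≠ 0) {q : ℕ} [hq : Fact q.Prime]
    (hqm : ¬ q ∣ m) :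
    atkinLehnerIdeal O m * normPrimeIdeal O q = normPrimeIdeal O q * atkinLehnerIdeal O m := by
  have hPr : normPrimeIdeal O q * O = normPrimeIdeal O q := by
    refine le_antisymm (Submodule.mul_le.mpr fun x hx a ha => mul_mem_normPrimeIdeal_right hO ha hx) fun x hx => ?_
    rw [← mul_one x]
    exact Submodule.mul_mem_mul hx hO.one_mem
  refine mul_comm_of_forall_localAt (order_mul_atkinLehnerIdeal hO) (atkinLehnerIdeal_mul_order hO)
    (order_mul_normPrimeIdeal hO) hPr fun r hr => ?_
  by_cases hrq : r = q
  · subst hrq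
    left
    exact localAt_atkinLehnerIdeal_of_coprime hO hm ((Nat.Prime.coprime_iff_not_dvd hr).mpr hqm).symm
  · right
    exact (localAt_eq_of_smul_le (normPrimeIdeal_le O q) hq.out.ne_zero
      ((Nat.coprime_primes hq.out hr).mpr (Ne.symm hrq)) fun x hx =>
        smul_le_normPrimeIdeal hO (Submodule.smul_mem_pointwise_smul x _ O hx)).symm

end Commute

namespace AtkinLehner

variable {p : ℕ} [hp : Fact p.Prime] {e : ℕ}

/-- **An Atkin–Lehner generator commutes with no integrally embedded quadratic element of unit
discriminant.** Let `U` be of Atkin–Lehner shape with `‖det U‖ = p^{-e}`, `e ≥ 1` (so `U₀₁` is a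
unit), and `G` of level shape with `G U = U G`. Then the `(0,1)` entry of the commutator gives
`G₀₀ ≡ G₁₁ (mod p)`, while `G₁₀ ≡ 0 (mod p)`; hence `disc G = (tr G)² − 4 det G = (G₀₀ − G₁₁)² + 4 G₀₁ G₁₀`
is NOT a `p`-adic unit. This is the matrix form of Bertolini–Darmon's *"the involution `W_{l⁺}` sends a
Heegner point to one with the opposite orientation at `l`"*: an optimally embedded order of conductor
prime to `l` at a split `l` (unit discriminant) is never normalised into itself by the Atkin–Lehner
element. [cite: BertoliniDarmon1996, §2.2–§2.3, Lemma 2.4 and proof of Lemma 2.5] -/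
theorem norm_disc_lt_one_of_commute (he : 1 ≤ e) {U G : Matrix (Fin 2) (Fin 2) ℚ_[p]} (hU : IsALShape e U)
    (hdet : ‖U.det‖ = (p : ℝ) ^ (-(e : ℤ))) (hG : IsLevelShape e G) (hcomm : G * U = U * G) :
    ‖G.trace ^ 2 - 4 * G.det‖ < 1 := by
  obtain ⟨u00, u01, u10, u11⟩ := hU
  obtain ⟨hGint, g10⟩ := hG
  set r := (p : ℝ) ^ (-(e : ℤ))
  have hr0 := zpow_neg_pos (p := p) e
  have hp1 : (1 : ℝ) < p := by exact_mod_cast hp.out.one_lt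
  have hr1 : r < 1 := zpow_lt_one_of_neg₀ hp1 (by omega)
  -- `U₀₁` is a unit
  have hprod : ‖U 0 1 * U 1 0‖ = r := by
    have hsmall : ‖U 0 0 * U 1 1‖ < r := by
      rw [norm_mul]
      exact (mul_le_mul u00 u11 (norm_nonneg _) hr0.le).trans_lt (by nlinarith)
    have e1 : U 0 1 * U 1 0 = U 0 0 * U 1 1 + -U.det := by rw [Matrix.det_fin_two]; ring
    rw [e1, Padic.add_eq_max_of_ne (by rw [norm_neg, hdet]; exact hsmall.ne), norm_neg, hdet]
    exact max_eq_right hsmall.le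
  have hb : ‖U 0 1‖ = 1 := by
    refine le_antisymm u01 ?_
    by_contra hlt
    push Not at hlt
    have : ‖U 0 1 * U 1 0‖ < r := by
      rw [norm_mul]
      calc ‖U 0 1‖ * ‖U 1 0‖ ≤ ‖U 0 1‖ * r := mul_le_mul_of_nonneg_left u10 (norm_nonneg _)
        _ < 1 * r := mul_lt_mul_of_pos_right hlt hr0
        _ = r := one_mul r
    exact this.ne hprod
  -- the `(0,1)` entry of `G U = U G`
  have h01 := congr_fun (congr_fun hcomm 0) 1
  simp only [Matrix.mul_apply, Fin.sum_univ_two] at h01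
  -- h01 : G 0 0 * U 0 1 + G 0 1 * U 1 1 = U 0 0 * G 0 1 + U 0 1 * G 1 1
  have hdiff : ‖G 0 0 - G 1 1‖ ≤ r := by
    have e1 : G 0 0 - G 1 1 = (U 0 1)⁻¹ * (U 0 0 * G 0 1 + -(G 0 1 * U 1 1)) := by
      have hb0 : U 0 1 ≠ 0 := fun h => by rw [h, norm_zero] at hb; exact zero_ne_one hb
      field_simp
      linear_combination h01
    rw [e1, norm_mul, norm_inv, hb, inv_one, one_mul, ← neg_mul]
    refine (norm_add_mul_le (s := r) (t := r) ?_ ?_).trans (max_le le_rfl le_rfl)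
    · exact (mul_le_mul u00 (hGint 0 1) (norm_nonneg _) hr0.le).trans (mul_one r).le
    · rw [norm_neg]; exact (mul_le_mul (hGint 0 1) u11 (norm_nonneg _) zero_le_one).trans (one_mul r).le
  -- the discriminant
  have e2 : G.trace ^ 2 - 4 * G.det = (G 0 0 - G 1 1) * (G 0 0 - G 1 1) + 4 * G 0 1 * G 1 0 := by
    rw [Matrix.trace_fin_two, Matrix.det_fin_two]; ring
  rw [e2]
  refine lt_of_le_of_lt (Padic.nonarchimedean _ _) (max_lt ?_ ?_)
  · rw [norm_mul]
    calc ‖G 0 0 - G 1 1‖ * ‖G 0 0 - G 1 1‖ ≤ r * r := mul_le_mul hdiff hdiff (norm_nonneg _) hr0.le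
      _ < 1 := by nlinarith
  · rw [norm_mul, norm_mul]
    have h4 : ‖(4 : ℚ_[p])‖ ≤ 1 := by
      have h := Padic.norm_int_le_one (p := p) (4 : ℤ)
      simpa using h
    calc ‖(4 : ℚ_[p])‖ * ‖G 0 1‖ * ‖G 1 0‖ ≤ 1 * 1 * r := by gcongr; exact hGint 0 1
      _ < 1 := by rw [one_mul, one_mul]; exact hr1

/-- **`W X` is Atkin–Lehner-shaped for `W` Atkin–Lehner-shaped and `X` level-shaped** (the local
Atkin–Lehner ideal is a right ideal of the level-`p^e` order). [cite: VignerasLNM800, Ch. II §2] -/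
theorem IsALShape.mul_isLevelShape {W X : Matrix (Fin 2) (Fin 2) ℚ_[p]} (hW : IsALShape e W)
    (hX : IsLevelShape e X) : IsALShape e (W * X) := by
  obtain ⟨w00, w01, w10, w11⟩ := hW
  obtain ⟨hXint, x10⟩ := hX
  set r := (p : ℝ) ^ (-(e : ℤ))
  have hr0 := zpow_neg_pos (p := p) e
  have hr1 := zpow_neg_le_one (p := p) e
  have hrr : r * r ≤ r := (mul_le_mul_of_nonneg_left hr1 hr0.le).trans (mul_one r).le
  refine ⟨?_, ?_, ?_, ?_⟩ <;> rw [Matrix.mul_apply, Fin.sum_univ_two]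
  · refine (norm_add_mul_le (s := r) (t := r) ?_ ?_).trans (max_le le_rfl le_rfl)
    · exact (mul_le_mul w00 (hXint 0 0) (norm_nonneg _) hr0.le).trans (mul_one r).le
    · exact (mul_le_mul w01 x10 (norm_nonneg _) zero_le_one).trans (one_mul r).le
  · refine (norm_add_mul_le (s := r) (t := 1) ?_ ?_).trans (max_le hr1 le_rfl)
    · exact (mul_le_mul w00 (hXint 0 1) (norm_nonneg _) hr0.le).trans (mul_one r).le
    · exact mul_le_one₀ w01 (norm_nonneg _) (hXint 1 1)
  · refine (norm_add_mul_le (s := r) (t := r) ?_ ?_).trans (max_le le_rfl le_rfl)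
    · exact (mul_le_mul w10 (hXint 0 0) (norm_nonneg _) hr0.le).trans (mul_one r).le
    · exact (mul_le_mul w11 x10 (norm_nonneg _) hr0.le).trans hrr
  · refine (norm_add_mul_le (s := r) (t := r) ?_ ?_).trans (max_le le_rfl le_rfl)
    · exact (mul_le_mul w10 (hXint 0 1) (norm_nonneg _) hr0.le).trans (mul_one r).le
    · exact (mul_le_mul w11 (hXint 1 1) (norm_nonneg _) hr0.le).trans (mul_one r).le

/-- **A level-shaped matrix with unit diagonal has unit determinant** (`e ≥ 1`: the off-diagonal
product lies in `p ℤ_p`); such matrices are the units of the local Eichler order, whose two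
"orientation" characters are `X ↦ X₀₀, X₁₁ (mod p)`. [cite: BertoliniDarmon1996, §1.1 (orientations), §2.2] -/
theorem norm_det_eq_one_of_diag (he : 1 ≤ e) {X : Matrix (Fin 2) (Fin 2) ℚ_[p]} (hX : IsLevelShape e X)
    (h00 : ‖X 0 0‖ = 1) (h11 : ‖X 1 1‖ = 1) : ‖X.det‖ = 1 := by
  obtain ⟨hXint, x10⟩ := hX
  have hp1 : (1 : ℝ) < p := by exact_mod_cast hp.out.one_lt
  have hr1 : (p : ℝ) ^ (-(e : ℤ)) < 1 := zpow_lt_one_of_neg₀ hp1 (by omega)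
  have hoff : ‖-(X 0 1 * X 1 0)‖ < 1 := by
    rw [norm_neg, norm_mul]
    exact (mul_le_mul (hXint 0 1) x10 (norm_nonneg _) zero_le_one).trans_lt (by rw [one_mul]; exact hr1)
  have hdiag : ‖X 0 0 * X 1 1‖ = 1 := by rw [norm_mul, h00, h11, one_mul]
  rw [Matrix.det_fin_two, sub_eq_add_neg, Padic.add_eq_max_of_ne (by rw [hdiag]; exact hoff.ne'), hdiag]
  exact max_eq_left hoff.le

/-- **The orientation characters are multiplicative, (0,0)**: for level-shaped `X, Y` (`e ≥ 1`),
`(X Y)₀₀ ≡ X₀₀ Y₀₀ (mod p)`; in particular `(X Y)₀₀` is a non-unit when `X₀₀` is. [cite: BertoliniDarmon1996, §1.1 (orientations)] -/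
theorem norm_mul_apply_zero_zero_lt_one (he : 1 ≤ e) {X Y : Matrix (Fin 2) (Fin 2) ℚ_[p]}
    (hX : IsLevelShape e X) (hY : IsLevelShape e Y) (h : ‖X 0 0‖ < 1) : ‖(X * Y) 0 0‖ < 1 := by
  have hp1 : (1 : ℝ) < p := by exact_mod_cast hp.out.one_lt
  have hr1 : (p : ℝ) ^ (-(e : ℤ)) < 1 := zpow_lt_one_of_neg₀ hp1 (by omega)
  rw [Matrix.mul_apply, Fin.sum_univ_two]
  refine lt_of_le_of_lt (Padic.nonarchimedean _ _) (max_lt ?_ ?_) <;> rw [norm_mul]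
  · exact (mul_le_of_le_one_right (norm_nonneg _) (hY.1 0 0)).trans_lt h
  · exact (mul_le_mul (hX.1 0 1) hY.2 (norm_nonneg _) zero_le_one).trans_lt (by rw [one_mul]; exact hr1)

/-- **The orientation characters are multiplicative, (1,1)**: for level-shaped `X, Y` (`e ≥ 1`),
`(X Y)₁₁ ≡ X₁₁ Y₁₁ (mod p)`; in particular `(X Y)₁₁` is a non-unit when `X₁₁` is. [cite: BertoliniDarmon1996, §1.1 (orientations)] -/
theorem norm_mul_apply_one_one_lt_one (he : 1 ≤ e) {X Y : Matrix (Fin 2) (Fin 2) ℚ_[p]}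
    (hX : IsLevelShape e X) (hY : IsLevelShape e Y) (h : ‖X 1 1‖ < 1) : ‖(X * Y) 1 1‖ < 1 := by
  have hp1 : (1 : ℝ) < p := by exact_mod_cast hp.out.one_lt
  have hr1 : (p : ℝ) ^ (-(e : ℤ)) < 1 := zpow_lt_one_of_neg₀ hp1 (by omega)
  rw [Matrix.mul_apply, Fin.sum_univ_two]
  refine lt_of_le_of_lt (Padic.nonarchimedean _ _) (max_lt ?_ ?_) <;> rw [norm_mul]
  · exact (mul_le_mul hX.2 (hY.1 0 1) (norm_nonneg _) (zpow_neg_pos e).le).trans_lt (by rw [mul_one]; exact hr1)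
  · exact (mul_le_of_le_one_right (norm_nonneg _) (hY.1 1 1)).trans_lt h

/-- **Level-shaped matrices form a ring**: `X Y` is level-shaped for level-shaped `X, Y`. [cite: VignerasLNM800, Ch. II §2] -/
theorem IsLevelShape.mul {X Y : Matrix (Fin 2) (Fin 2) ℚ_[p]} (hX : IsLevelShape e X) (hY : IsLevelShape e Y) :
    IsLevelShape e (X * Y) := by
  set r := (p : ℝ) ^ (-(e : ℤ))
  have hr0 := zpow_neg_pos (p := p) e
  refine ⟨Padic.norm_mul_apply_le_one hX.1 hY.1, ?_⟩
  rw [Matrix.mul_apply, Fin.sum_univ_two]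
  refine (norm_add_mul_le (s := r) (t := r) ?_ ?_).trans (max_le le_rfl le_rfl)
  · exact (mul_le_mul hX.2 (hY.1 0 0) (norm_nonneg _) hr0.le).trans (mul_one r).le
  · exact (mul_le_mul (hX.1 1 1) hY.2 (norm_nonneg _) zero_le_one).trans (one_mul r).le

end AtkinLehner

/-! ### §5 Level models for Eichler packages and Brandt setups -/

section Model

open AtkinLehner

/-- **Every Eichler package has a level model at a prime `p ∤ N⁻`**: a `ℚ`-algebra map
`Φ : B → M₂(ℚ_p)` with `O_(p) = Φ⁻¹(ℤ_p, ℤ_p; p^e ℤ_p, ℤ_p)`, `e = v_p(N⁺)` (the tree's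
`IsEichlerOrder.exists_conjUnit_localAt_iff_eichler` composed with a matrix model at the unramified
`p`). [cite: VignerasLNM800, Ch. II §2 Lemme 2.4, Ch. III §5 Prop. 5.1] -/
theorem EichlerPackage.exists_isLevelShape_iff {Nplus Nminus : ℕ} (P : EichlerPackage Nplus Nminus)
    (hN : Nplus ≠ 0) {p : ℕ} [Fact p.Prime] (hpm : ¬ p ∣ Nminus) :
    ∃ Φ : P.B →ₐ[ℚ] Matrix (Fin 2) (Fin 2) ℚ_[p],
      ∀ y : P.B, y ∈ localAt p P.O ↔ IsLevelShape (Nplus.factorization p) (Φ y) := by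
  have hD : ∀ x : P.B, x ≠ 0 → IsUnit x := fun _ hx => isUnit_of_isTotallyDefinite P.B P.isTotallyDefinite hx
  obtain ⟨φ⟩ := exists_algHom_matrix_of_not_dvd (B := P.B) P.mem_ramifiedPlaces_iff hpm
  obtain ⟨u, hu⟩ := P.isEichlerOrder.exists_conjUnit_localAt_iff_eichler hD hN φ
  exact ⟨AlgHom.conjUnit φ u, hu⟩

/-- **Every Brandt setup `S : XiSetup N⁺ N⁻` has a level model at a prime `p ∤ N⁻`.** [cite: VignerasLNM800, Ch. II §2 Lemme 2.4, Ch. III §5 Prop. 5.1] -/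
theorem Brandt.XiSetup.exists_isLevelShape_iff {Nplus Nminus : ℕ} (S : Brandt.XiSetup Nplus Nminus)
    (hN : Nplus ≠ 0) {p : ℕ} [Fact p.Prime] (hpm : ¬ p ∣ Nminus) :
    ∃ Φ : S.D →ₐ[ℚ] Matrix (Fin 2) (Fin 2) ℚ_[p],
      ∀ y : S.D, y ∈ localAt p S.O ↔ IsLevelShape (Nplus.factorization p) (Φ y) :=
  S.toEichlerPackage.exists_isLevelShape_iff hN hpm

end Model

end Literature.NumberTheory.Automorphic

end
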